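import Summits.BirchSwinnertonDyer.BirchSwinnertonDyer.Theorems.BiquadraticEisensteinDescentHeegnerTwistCouplingInSupplySymbolicMonskyDesign
import Summits.BirchSwinnertonDyer.BirchSwinnertonDyer.Theorems.BiquadraticEisensteinDescentHeegnerTwistCouplingInSupplySymbolicMonskyTransversal
import Summits.BirchSwinnertonDyer.BirchSwinnertonDyer.Theorems.BiquadraticEisensteinDescentSymbolicMonskyKernelDefs
import HarnessLib

set_option linter.dupNamespace false -- `Summit.BirchSwinnertonDyer.BirchSwinnertonDyer.Theorems.…` (summit = sub)
set_option autoImplicit false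

/-!
# Crux `HeegnerTwistCouplingInSupply` (stmt-BirchSwinnertonDyer-21381) — ★★ UNIFORM EXISTENCE of pattern-free Heegner recipes at `t = t₀` (THEOREM A:
# every `k`, every base whose augmented virtual kernel meets the three coordinate planes in half its dimension)

Route `BiquadraticEisensteinDescent` (cell `pub/bsd-wall`, width seat `bsd-wall-cm-bed-w3` g22; `--supports` 21381, helper). The capstone of the
files `…SymbolicMonskyTransversal{Tools,}` (the `𝔽₂` transversality theorem), `…SymbolicMonskyDesign{Rows,Core,}` (the general-`τ` design
criterion) and the reviewed `…SymbolicMonskyKernelDefs` (`virtualKernel`, `augKernel`).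

★★ `exists_patternFree_design`. Let `base : SymbData (k+1)` be ANY base datum (primes `P₀ … P_k` of the congruent number `n₀`), `δ ∈ 𝔽₂^(k+1)` with
`(δ, 1) ∉ 𝒦 := base.virtualKernel`, and suppose the augmented kernel `𝒦⁺ = 𝒦 + ⟨(δ, 1)⟩` has dimension `2τ` and meets `V × 0`, `0 × V` and the
diagonal `{(x, x)}` in dimension `≤ τ` each. THEN there are `τ` free cells `rest` (primes `q_(i+1) ≡ 1 (mod 4)` with prescribed symbols against the
base) and the Heegner-forced cell `c₁` (`q₁ ≡ 3 (mod 4)`) such that `heegnerK base (c₁ :: rest)` holds and Monsky's odd matrix of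
`(base, c₁ :: rest, pat)` is invertible for EVERY mutual pattern `pat` — a PATTERN-FREE HEEGNER RECIPE WITH `τ + 1` AUXILIARY PRIMES.
In the memos' language (PATTERN-FREE-STRUCTURE-w3g21 §2–§5, THEOREM-A-w3g22): `dim 𝒦⁺ = s* = 2τ₀`, the three intersections are `κ_u + ε`,
`κ_w + [δ ∈ 𝒰]`, `κ_v + [δ + 1 ∈ 𝒱]`, so every configuration with `t_pred = t₀` (all but a thin aligned class: 2 of 4096 at `k = 3`, 13 of 20 000
sampled at `k = 4`) owns a pattern-free recipe with the OPTIMAL number `t₀ = s*/2 + 1` of auxiliary primes, at every `k`. The `s* = 2` theorem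
`…SymbolicMonskyTwoPrime` (w3 g21) is the case `τ = 1`.
Proof: `Transversal.exists_dual_family_separating_prod` gives `τ` linear forms `f_i` separating `𝒦⁺`; their coordinate vectors `σ_i` are the symbol
vectors of the free cells, `d'_i = f_i(δ)` their `(2/·)`-classes; injectivity of `w ↦ (f_i(w.1), f_i(w.2))_i` on `𝒦⁺` plus `dim 𝒦⁺ = 2τ` give
bijectivity, which is exactly the pair of hypotheses (span), (inj) of `design_recipe` (`design_recipe_ofFn` does the list bookkeeping).

HONEST FRAMING: RUNG-LEVEL corner layer (congruent `j = 1728` families `E_(n₀)`); an existence theorem about Monsky matrices — instances of the crux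
still need located primes (doors `…PatternFreeDoor` / `…ClosureSymb`, Linnik censuses) and the print inputs (Burungale–Tian); the EXCEPTIONAL class
`t_pred > t₀` is not covered; the crux as stated (C⁺), its registered stubs and BSD are NOT touched; nothing is closed. THEOREMS ONLY.
Reference: [HeathBrown1994] appendix (Monsky), typescript pp. 39–41.
-/

namespace Summit.BirchSwinnertonDyer.BirchSwinnertonDyer.Theorems.SymbolicMonsky

section DesignExists

open Matrix Module

variable {k : ℕ} (base : SymbData (k + 1))

/-! ### Small tools -/

/-- Membership in the virtual kernel, unfolded. -/
theorem mem_virtualKernel_iff (p : (Fin (k + 1) → ZMod 2) × (Fin (k + 1) → ZMod 2)) :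
    p ∈ base.virtualKernel ↔
      (∀ i, (∑ j, bz (base.neg i j) * (p.1 j + p.1 i)) + bz (negNegOne (base.cls i)) * p.1 i + bz (negTwo (base.cls i)) * p.2 i = 0) ∧
      (∀ i, bz (negNegOne (base.cls i)) * p.1 i + ∑ j, bz (base.neg i j) * (p.2 j + p.2 i) = 0) := Iff.rfl

/-- Elements of the augmented kernel are `q + γ(δ, 1)` with `q` in the virtual kernel. -/
theorem exists_of_mem_augKernel (δ : Fin (k + 1) → ZMod 2) {p : (Fin (k + 1) → ZMod 2) × (Fin (k + 1) → ZMod 2)}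
    (hp : p ∈ base.augKernel δ) :
    ∃ q ∈ base.virtualKernel, ∃ γ : ZMod 2, p = q + γ • (δ, fun _ => (1 : ZMod 2)) := by
  unfold SymbData.augKernel at hp
  rw [Submodule.mem_sup] at hp
  obtain ⟨q, hq, l, hl, rfl⟩ := hp
  rw [Submodule.mem_span_singleton] at hl
  obtain ⟨γ, rfl⟩ := hl
  exact ⟨q, hq, γ, rfl⟩

/-- `q + γ(δ,1)` lies in the augmented kernel when `q` is a virtual kernel pair. -/
theorem add_smul_mem_augKernel (δ : Fin (k + 1) → ZMod 2) {q : (Fin (k + 1) → ZMod 2) × (Fin (k + 1) → ZMod 2)}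
    (hq : q ∈ base.virtualKernel) (γ : ZMod 2) : q + γ • (δ, fun _ => (1 : ZMod 2)) ∈ base.augKernel δ := by
  unfold SymbData.augKernel
  exact Submodule.add_mem_sup hq (Submodule.smul_mem _ γ (Submodule.subset_span rfl))

/-- A linear form on `Fin n → ZMod 2` is the dot product with its values on the coordinate vectors. [folklore] -/
theorem dual_apply_eq_sum {n : ℕ} (f : Dual (ZMod 2) (Fin n → ZMod 2)) (x : Fin n → ZMod 2) :
    f x = ∑ b, f (fun j => if b = j then 1 else 0) * x b := by
  rw [LinearMap.pi_apply_eq_sum_univ]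
  exact Finset.sum_congr rfl fun b _ => by rw [smul_eq_mul, mul_comm]

/-- `bz (decide (x = 1)) = x` in `ZMod 2`. -/
private theorem bz_decide_eq_one (x : ZMod 2) : bz (decide (x = 1)) = x := by
  revert x; decide

/-- `(List.ofFn g).getD i dflt = g i`. -/
private theorem getD_ofFn {α : Type*} {n : ℕ} (g : Fin n → α) (dflt : α) (i : ℕ) (hi : i < n) :
    (List.ofFn g).getD i dflt = g ⟨i, hi⟩ := by
  rw [List.getD_eq_getElem?_getD, List.getElem?_ofFn]
  simp [hi]

/-! ### The design criterion with `Fin τ`-indexed cells -/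

/-- `design_recipe` for a cell list given as `List.ofFn` (index bookkeeping `Fin (List.ofFn cells).length ≃ Fin τ`). -/
theorem design_recipe_ofFn (τ : ℕ) (c₁ : AuxCell) (cells : Fin τ → AuxCell)
    (hm1 : negNegOne c₁.1 = true) (hmr : ∀ i, negNegOne (cells i).1 = false)
    (σ : Fin τ → Fin (k + 1) → ZMod 2) (hσ : ∀ i b, bz ((cells i).2.testBit b.val) = σ i b)
    (hσ1 : ∀ b : Fin (k + 1), bz (c₁.2.testBit b.val) = bz (negNegOne (base.cls b)) + ∑ i, σ i b)
    (dp : Fin τ → ZMod 2) (hdp : ∀ i, bz (negTwo (cells i).1) = dp i) (hd1 : bz (negTwo c₁.1) = ∑ i, dp i)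
    (hspan : ∀ a e : Fin τ → ZMod 2,
      (∀ x y : Fin (k + 1) → ZMod 2, (∀ i, (∑ j, bz (base.neg i j) * (x j + x i)) + bz (negNegOne (base.cls i)) * x i + bz (negTwo (base.cls i)) * y i = 0) →
        (∀ i, bz (negNegOne (base.cls i)) * x i + ∑ j, bz (base.neg i j) * (y j + y i) = 0) →
        (∑ i, (a i * (∑ b, σ i b * y b) + e i * (∑ b, σ i b * x b))) = 0) →
      (∑ i, ((∑ b, σ i b) * a i + dp i * e i)) = 0 → (∀ i, a i = 0) ∧ (∀ i, e i = 0))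
    (hF : ∀ (x y : Fin (k + 1) → ZMod 2) (γ : ZMod 2), (∀ i, (∑ j, bz (base.neg i j) * (x j + x i)) + bz (negNegOne (base.cls i)) * x i + bz (negTwo (base.cls i)) * y i = 0) →
        (∀ i, bz (negNegOne (base.cls i)) * x i + ∑ j, bz (base.neg i j) * (y j + y i) = 0) →
        (∀ i : Fin τ, (∑ b, σ i b * x b) + γ * dp i = 0) → (∀ i : Fin τ, (∑ b, σ i b * y b) + γ * ∑ b, σ i b = 0) →
        γ = 0 ∧ x = 0 ∧ y = 0) :
    heegnerK base (c₁ :: List.ofFn cells) = true ∧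
      ∀ pat : ℕ → ℕ → Bool, (dataK base (c₁ :: List.ofFn cells) pat).monskyOddS.det = 1 := by
  have hlen : (List.ofFn cells).length = τ := List.length_ofFn
  set e : Fin (List.ofFn cells).length ≃ Fin τ := finCongr hlen with he
  have hget : ∀ i : Fin (List.ofFn cells).length, (List.ofFn cells).getD i.val (0, 0) = cells (e i) := fun i =>
    getD_ofFn cells (0, 0) i.val (lt_of_lt_of_eq i.isLt hlen)
  have hsumσ : ∀ (g : Fin τ → ZMod 2), (∑ i : Fin (List.ofFn cells).length, g (e i)) = ∑ i, g i := fun g =>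
    Fintype.sum_equiv e _ _ (fun _ => rfl)
  refine design_recipe base c₁ (List.ofFn cells) hm1 (fun i => by rw [hget]; exact hmr _) (fun i b => σ (e i) b)
    (fun i b => by rw [hget]; exact hσ _ b) (fun b => by rw [hσ1 b, hsumσ (fun i => σ i b)]) (fun i => dp (e i))
    (fun i => by rw [hget]; exact hdp _) (by rw [hd1, hsumσ dp]) ?_ ?_
  · -- (span)
    intro a' e' h1 h2
    have h := hspan (fun j => a' (e.symm j)) (fun j => e' (e.symm j)) (fun x y hx hy => by
        rw [← hsumσ]; simpa only [Equiv.symm_apply_apply] using h1 x y hx hy)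
      (by rw [← hsumσ]; simpa only [Equiv.symm_apply_apply] using h2)
    exact ⟨fun i => by simpa using h.1 (e i), fun i => by simpa using h.2 (e i)⟩
  · -- (inj)
    intro x y γ hx hy h3 h4
    exact hF x y γ hx hy (fun j => by simpa using h3 (e.symm j)) (fun j => by simpa using h4 (e.symm j))

/-! ### ★★ THEOREM A: the uniform existence theorem -/

/-- ★★ **UNIFORM EXISTENCE OF PATTERN-FREE HEEGNER RECIPES AT `t = t₀` (THEOREM A).** For ANY base datum and any `δ` with `(δ, 1)` not a
virtual kernel pair: if the augmented virtual kernel `𝒦⁺ = 𝒦 + ⟨(δ,1)⟩` has dimension `2τ` and meets `V × 0`, `0 × V` and the diagonal in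
dimension `≤ τ`, then a pattern-free Heegner recipe with `τ` free cells (so `τ + 1` auxiliary primes) EXISTS: `heegnerK ∧ ∀ pat, det M_odd = 1`.
See the module docstring for the dictionary with `s*`, `κ_u + ε`, `κ_w`, `κ_v` and the census coverage.
[cite: HeathBrown1994SelmerCongruentII, Appendix (Monsky), typescript p. 39 L27–L33] -/
theorem exists_patternFree_design (δ : Fin (k + 1) → ZMod 2) (τ : ℕ)
    (hδ : ((δ, fun _ => (1 : ZMod 2)) : (Fin (k + 1) → ZMod 2) × (Fin (k + 1) → ZMod 2)) ∉ base.virtualKernel)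
    (hdim : finrank (ZMod 2) ↥(base.augKernel δ) = 2 * τ)
    (h1 : finrank (ZMod 2) ↥(base.augKernel δ ⊓ LinearMap.ker (LinearMap.snd (ZMod 2) (Fin (k + 1) → ZMod 2) (Fin (k + 1) → ZMod 2))) ≤ τ)
    (h2 : finrank (ZMod 2) ↥(base.augKernel δ ⊓ LinearMap.ker (LinearMap.fst (ZMod 2) (Fin (k + 1) → ZMod 2) (Fin (k + 1) → ZMod 2))) ≤ τ)
    (h3 : finrank (ZMod 2) ↥(base.augKernel δ ⊓ LinearMap.ker (LinearMap.fst (ZMod 2) (Fin (k + 1) → ZMod 2) (Fin (k + 1) → ZMod 2) +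
      LinearMap.snd (ZMod 2) (Fin (k + 1) → ZMod 2) (Fin (k + 1) → ZMod 2))) ≤ τ) :
    ∃ (c₁ : AuxCell) (rest : List AuxCell), rest.length = τ ∧ heegnerK base (c₁ :: rest) = true ∧
      ∀ pat : ℕ → ℕ → Bool, (dataK base (c₁ :: rest) pat).monskyOddS.det = 1 := by
  classical
  obtain ⟨f, hf⟩ := Transversal.exists_dual_family_separating_prod τ (base.augKernel δ) hdim h1 h2 h3
  -- the symbol vectors and classes of the free cells
  set σ : Fin τ → Fin (k + 1) → ZMod 2 := fun i b => f i (fun j => if b = j then 1 else 0) with hσdef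
  have hfx : ∀ i (x : Fin (k + 1) → ZMod 2), f i x = ∑ b, σ i b * x b := fun i x => dual_apply_eq_sum (f i) x
  have hc : ∀ i, (∑ b, σ i b) = f i (fun _ => 1) := fun i => by
    rw [hfx]; exact Finset.sum_congr rfl fun b _ => by ring
  -- the cells
  set cells : Fin τ → AuxCell := fun i =>
    ((if f i δ = 1 then 2 else 0 : Fin 4), ofBits (List.ofFn fun b : Fin (k + 1) => decide (σ i b = 1))) with hcells
  set c₁ : AuxCell := ((if (∑ i, f i δ) = 1 then 1 else 3 : Fin 4),
    ofBits (List.ofFn fun b : Fin (k + 1) => xor (negNegOne (base.cls b)) (decide ((∑ i, σ i b) = 1)))) with hc₁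
  refine ⟨c₁, List.ofFn cells, List.length_ofFn, ?_⟩
  refine design_recipe_ofFn base τ c₁ cells ?_ ?_ σ ?_ ?_ (fun i => f i δ) ?_ ?_ ?_ ?_
  · -- q₁ ≡ 3 (4)
    show negNegOne (if (∑ i, f i δ) = 1 then 1 else 3 : Fin 4) = true
    split_ifs <;> rfl
  · intro i
    show negNegOne (if f i δ = 1 then 2 else 0 : Fin 4) = false
    split_ifs <;> rfl
  · intro i b
    show bz ((ofBits (List.ofFn fun b : Fin (k + 1) => decide (σ i b = 1))).testBit b.val) = σ i b
    rw [testBit_ofBits_ofFn, bz_decide_eq_one]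
  · intro b
    show bz ((ofBits (List.ofFn fun b : Fin (k + 1) => xor (negNegOne (base.cls b)) (decide ((∑ i, σ i b) = 1)))).testBit b.val) = _
    rw [testBit_ofBits_ofFn, bz_xor_add, bz_decide_eq_one]
  · intro i
    show bz (negTwo (if f i δ = 1 then 2 else 0 : Fin 4)) = f i δ
    by_cases h : f i δ = 1
    · rw [if_pos h, h]; rfl
    · rw [if_neg h]
      rcases zmod_two_eq_zero_or_eq_one (f i δ) with h0 | h1'
      · rw [h0]; rfl
      · exact absurd h1' h
  · show bz (negTwo (if (∑ i, f i δ) = 1 then 1 else 3 : Fin 4)) = ∑ i, f i δ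
    by_cases h : (∑ i, f i δ) = 1
    · rw [if_pos h, h]; rfl
    · rw [if_neg h]
      rcases zmod_two_eq_zero_or_eq_one (∑ i, f i δ) with h0 | h1'
      · rw [h0]; rfl
      · exact absurd h1' h
  · -- (span): surjectivity of w ↦ (f_i(w.1), f_i(w.2))_i on W
    intro a e H1 H2
    -- the evaluation map
    let ρ : ↥(base.augKernel δ) →ₗ[ZMod 2] (Fin τ → ZMod 2) × (Fin τ → ZMod 2) :=
      LinearMap.prod
        (LinearMap.pi fun i => (f i).comp ((LinearMap.fst (ZMod 2) (Fin (k + 1) → ZMod 2) (Fin (k + 1) → ZMod 2)).comp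
          (base.augKernel δ).subtype))
        (LinearMap.pi fun i => (f i).comp ((LinearMap.snd (ZMod 2) (Fin (k + 1) → ZMod 2) (Fin (k + 1) → ZMod 2)).comp
          (base.augKernel δ).subtype))
    have hρ : ∀ w : ↥(base.augKernel δ), ρ w = (fun i => f i (w : (Fin (k + 1) → ZMod 2) × (Fin (k + 1) → ZMod 2)).1,
        fun i => f i (w : (Fin (k + 1) → ZMod 2) × (Fin (k + 1) → ZMod 2)).2) := fun w => rfl
    have hinj : Function.Injective ρ := by
      rw [← LinearMap.ker_eq_bot, LinearMap.ker_eq_bot']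
      intro w hw
      rw [hρ] at hw
      have h1' : ∀ i, f i (w : (Fin (k + 1) → ZMod 2) × (Fin (k + 1) → ZMod 2)).1 = 0 := fun i => by
        have := congrArg (fun q => q.1 i) hw; simpa using this
      have h2' : ∀ i, f i (w : (Fin (k + 1) → ZMod 2) × (Fin (k + 1) → ZMod 2)).2 = 0 := fun i => by
        have := congrArg (fun q => q.2 i) hw; simpa using this
      exact Subtype.ext (hf w w.2 h1' h2')
    have hrank : finrank (ZMod 2) ↥(base.augKernel δ) = finrank (ZMod 2) ((Fin τ → ZMod 2) × (Fin τ → ZMod 2)) := by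
      rw [hdim, Module.finrank_prod, Module.finrank_fintype_fun_eq_card, Fintype.card_fin]; ring
    have hsurj : Function.Surjective ρ := (LinearMap.injective_iff_surjective_of_finrank_eq_finrank hrank).mp hinj
    -- the functional Φ(w) = Σ_i (a_i f_i(w.2) + e_i f_i(w.1)) vanishes on W
    have hΦ : ∀ w : ↥(base.augKernel δ), (∑ i, (a i * f i (w : (Fin (k + 1) → ZMod 2) × (Fin (k + 1) → ZMod 2)).2 + e i * f i (w : (Fin (k + 1) → ZMod 2) × (Fin (k + 1) → ZMod 2)).1)) = 0 := by
      intro w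
      obtain ⟨q, hq, γ, hqw⟩ := exists_of_mem_augKernel base δ w.2
      rw [mem_virtualKernel_iff] at hq
      have H1' := H1 q.1 q.2 hq.1 hq.2
      have e1 : ∀ i, f i (w : (Fin (k + 1) → ZMod 2) × (Fin (k + 1) → ZMod 2)).1 = (∑ b, σ i b * q.1 b) + γ * f i δ := fun i => by
        rw [hqw]; simp only [Prod.fst_add, Prod.smul_fst, map_add, map_smul, smul_eq_mul, hfx i q.1]
      have e2 : ∀ i, f i (w : (Fin (k + 1) → ZMod 2) × (Fin (k + 1) → ZMod 2)).2 = (∑ b, σ i b * q.2 b) + γ * ∑ b, σ i b := fun i => by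
        rw [hqw]; simp only [Prod.snd_add, Prod.smul_snd, map_add, map_smul, smul_eq_mul, hfx i q.2, hc i]
      simp only [e1, e2]
      have : (∑ i, (a i * ((∑ b, σ i b * q.2 b) + γ * ∑ b, σ i b) + e i * ((∑ b, σ i b * q.1 b) + γ * f i δ))) =
          (∑ i, (a i * (∑ b, σ i b * q.2 b) + e i * (∑ b, σ i b * q.1 b))) + γ * ∑ i, ((∑ b, σ i b) * a i + f i δ * e i) := by
        rw [Finset.mul_sum, ← Finset.sum_add_distrib]; exact Finset.sum_congr rfl fun i _ => by ring
      rw [this, H1', H2, mul_zero, add_zero]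
    constructor
    · intro j
      obtain ⟨w, hw⟩ := hsurj (0, Pi.single j 1)
      have hw1 : ∀ i, f i (w : (Fin (k + 1) → ZMod 2) × (Fin (k + 1) → ZMod 2)).1 = 0 := fun i => by
        have := congrArg (fun q => q.1 i) hw; rw [hρ] at this; simpa using this
      have hw2 : ∀ i, f i (w : (Fin (k + 1) → ZMod 2) × (Fin (k + 1) → ZMod 2)).2 = if i = j then 1 else 0 := fun i => by
        have := congrArg (fun q => q.2 i) hw; rw [hρ] at this; simpa [Pi.single_apply] using this
      have := hΦ w
      simp only [hw1, hw2, mul_zero, add_zero, mul_ite, mul_one, Finset.sum_ite_eq', Finset.mem_univ, if_true] at this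
      exact this
    · intro j
      obtain ⟨w, hw⟩ := hsurj (Pi.single j 1, 0)
      have hw1 : ∀ i, f i (w : (Fin (k + 1) → ZMod 2) × (Fin (k + 1) → ZMod 2)).1 = if i = j then 1 else 0 := fun i => by
        have := congrArg (fun q => q.1 i) hw; rw [hρ] at this; simpa [Pi.single_apply] using this
      have hw2 : ∀ i, f i (w : (Fin (k + 1) → ZMod 2) × (Fin (k + 1) → ZMod 2)).2 = 0 := fun i => by
        have := congrArg (fun q => q.2 i) hw; rw [hρ] at this; simpa using this
      have := hΦ w
      simp only [hw1, hw2, mul_zero, zero_add, mul_ite, mul_one, Finset.sum_ite_eq', Finset.mem_univ, if_true] at this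
      exact this
  · -- (inj): separation on W and `(δ,1) ∉ 𝒦`
    intro x y γ hx hy h3 h4
    have hmem : ((x, y) : (Fin (k + 1) → ZMod 2) × (Fin (k + 1) → ZMod 2)) + γ • (δ, fun _ => (1 : ZMod 2)) ∈ base.augKernel δ :=
      add_smul_mem_augKernel base δ ((mem_virtualKernel_iff base (x, y)).mpr ⟨hx, hy⟩) γ
    have hz := hf _ hmem (fun i => by
        simp only [Prod.fst_add, Prod.smul_fst, map_add, map_smul, smul_eq_mul, hfx i x]; exact h3 i)
      (fun i => by
        simp only [Prod.snd_add, Prod.smul_snd, map_add, map_smul, smul_eq_mul, hfx i y, ← hc i]; exact h4 i)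
    have hx' : x = γ • δ := by
      have := congrArg Prod.fst hz
      simp only [Prod.fst_add, Prod.smul_fst, Prod.fst_zero] at this
      exact Transversal.eq_of_add_eq_zero_F2 this
    have hy' : y = γ • (fun _ => (1 : ZMod 2)) := by
      have := congrArg Prod.snd hz
      simp only [Prod.snd_add, Prod.smul_snd, Prod.snd_zero] at this
      exact Transversal.eq_of_add_eq_zero_F2 this
    rcases zmod_two_eq_zero_or_eq_one γ with hγ | hγ
    · refine ⟨hγ, ?_, ?_⟩
      · rw [hx', hγ, zero_smul]
      · rw [hy', hγ, zero_smul]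
    · exfalso
      apply hδ
      rw [hγ, one_smul] at hx' hy'
      have hp : ((δ, fun _ => (1 : ZMod 2)) : (Fin (k + 1) → ZMod 2) × (Fin (k + 1) → ZMod 2)) = (x, y) := by rw [hx', hy']
      rw [hp, mem_virtualKernel_iff]
      exact ⟨hx, hy⟩

end DesignExists

end Summit.BirchSwinnertonDyer.BirchSwinnertonDyer.Theorems.SymbolicMonsky
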